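/-
Origin: expansion seat `planner-pub-hodgecm-mc-axioms-1-g14-0`, handover #W12 2026-08-20T15:53:55Z md5 3428883d554b (PKG ea99b466acb5 → 3428883d554b; 80 l.; MECHANICAL (iib-R) rewrite v3.1 of the PKG file as it stands (26 token edits; rules R1x1+RX[h₂]x25)) (`HOME/mc/pub-hodgecm-mc-axioms-1-g14/revendor/kit-r55/stage55/HodgeCM/Model/HLiuOfCommonReflex.lean`, md5 3428883d554b, 80 lines);
landed by the gen-22 packager (p-g22) in gate run 55 REPLACES the earlier landed copy of `HodgeCM/Model/HLiuOfCommonReflex.lean` (seat copy carried the packager Origin header of an earlier run (stripped)).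
-/
/-
Copyright (c) 2026 the pub-hodgecm formalisation cell (harness21).  New file, not vendored.
Origin: HOME/mc/pub-hodgecm-mc-axioms-1-g12/lean/jliu/HodgeCM/Model/HLiuOfCommonReflex.lean — session
planner-pub-hodgecm-mc-axioms-1-g12-0 (unit pub-hodgecm-mc-axioms-1-g12, CONSTRUCTION PROVER gen 12 of lineage mc-axioms-1,
node N-i1 (L-lvl)), 2026-08-20.  Intended final place: `HodgeCM/Model/HLiuOfCommonReflex.lean` (NEW additive MODEL leaf at
node E's model term; imports `HodgeCM.Model.HLiuOfSmallLevel` (RUN 37, 34a5e1c4a59d) and `HodgeCM.Model.HsmallOfCommonReflex`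
(RUN 38 #5); nothing imports it).  The (J-Liu-iso) junction COMPOSED AT E: the kernel check that the conclusion of
`hsmall_of_commonReflexInput` at `R := thetaModelOf …` IS E's binder `hsmall` (it is fed, unmodified, to `hLiu_of_smallLevel`).
-/
import Summits.HodgeConjecture.HodgeCM.Model.HLiuOfSmallLevel
import Summits.HodgeConjecture.HodgeCM.Model.HsmallOfCommonReflex

set_option autoImplicit false

/-!
# E's binder `hLiu` from a common-reflex factorisation of the model's theta classes

`HodgeCM.Model.hLiu_of_commonReflexInput` — for THE END STATE's theta model
`R := thetaModelOf hHD hI h₁ h₃ h (embOf …) (coverOf … hA) (wmOfInput W) (thetaOf …) (d12Of μ) (d34Of μ)`: the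
row-9 CONCLUSION of `Model.hLiu_of_smallLevel` (E's former binder `hLiu`, text verbatim) from Riemann's fullness `hR` and
the per-level common-reflex factorisation hypothesis `hΘ` of `Model.hsmall_of_commonReflexInput` — by the literal composition
`hLiu_of_smallLevel … (hsmall_of_commonReflexInput … hR R hΘ)`.  KERNEL CONTENT: none beyond its two imports; its point is
that the composition TYPECHECKS, i.e. `hsmall_of_commonReflexInput`'s conclusion at `R` is E's `hsmall` binder on the nose
(`_r18AE`, `Model/E2InstanceR18AE.lean`), so that row 9 of the ledger reads `hsmall ⇐ hΘ` with nothing in between.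

`hΘ` (CONTENT, not here; lanes (P-i)/(J-Liu-Θ)/(J-Liu-K), [Liu21] = arXiv:2102.11518 Thm 4.15 / 4.18 + proof (4.3)): per
good seesaw context with `[c.K:ℚ] = 6` and `i : Fin 4`, a level `Γ₀` below which the theta classes `R.Theta V c i Γ` lie in the
span of the classes `(f^*)_ℂ α` of SOME `D : CommonReflexInput c.K (c.Ψ i) c.σ` on THE realised surface `P_Γ`.
-/

noncomputable section

namespace HodgeCM

namespace Model

open HodgeCM.Universe (ThetaModel)
open Literature.AlgebraicGeometry.HodgeTheory
open Literature.NumberTheory.Automorphic.PicardCM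
open Literature.NumberTheory.Transcendental (Arapura2012_Cor_15_4_6)
open HodgeCM.CMTypeOps (inflate)
open HodgeCM.Model.ThetaSpace

variable (hHD : exists_isReal_hodgeModel) (hI : hodgePQ_independent_of_hodgeModel)
  (h₁ : BallQuotientUniformised)  (h₃ : CMAbelianVarietyRealised)

/-- **E's `hLiu` from `hΘ`.**  The conclusion of `Model.hLiu_of_smallLevel` (all levels `Γ`; E's row-9 text) for THE model
`thetaModelOf …`, from `hR : DeligneMilne1982_Thm_6_20_full` and the common-reflex factorisation hypothesis `hΘ` at small
level — `hLiu_of_smallLevel ∘ hsmall_of_commonReflexInput`. [folklore] -/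
theorem hLiu_of_commonReflexInput (h : Bool) (hA : Arapura2012_Cor_15_4_6)
    (W : ∀ {L : CMField} {ι₁ : L →+* ℂ} (V : HermSpace3 L ι₁) (c : SeesawCtx L), WmInput V c.D)
    (S : ∀ {L : CMField} {ι₁ : L →+* ℂ} (V : HermSpace3 L ι₁) (c : SeesawCtx L), ThetaAdelicSide V c)
    (μ : ∀ {L : CMField}, SeesawCtx L → Fin 4 → NumberField.InfinitePlace L → ℤ)
    (hR : DeligneMilne1982_Thm_6_20_full)
    (hΘ : ∀ {L : CMField} {ι₁ : L →+* ℂ} (V : HermSpace3 L ι₁) (c : SeesawCtx L),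
      (thetaModelOf hHD hI h₁ h₃ h (embOf hHD hI h₁ h₃) (coverOf hHD hI h₁ h₃ hA) (wmOfInput W) (thetaOf _ (thetaClassInputOf _ (fun V c => thetaSpaceInputOf hHD hI h₁ h₃ S V c))) (d12Of μ) (d34Of μ)).GoodCtx ι₁ c → Module.finrank ℚ c.K = 6 →
      ∀ i : Fin 4, ∃ Γ₀ : Level V, ∀ Γ ≤ Γ₀,
        ∃ D : CommonReflexInput c.K (c.Ψ i) c.σ,
          (thetaModelOf hHD hI h₁ h₃ h (embOf hHD hI h₁ h₃) (coverOf hHD hI h₁ h₃ hA) (wmOfInput W) (thetaOf _ (thetaClassInputOf _ (fun V c => thetaSpaceInputOf hHD hI h₁ h₃ S V c))) (d12Of μ) (d34Of μ)).Theta V c i Γ ⊆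
            Submodule.span ℂ (D.surfaceClasses hHD hI h₁ h₃ V Γ)) :
    ∀ {L : CMField} {ι₁ : L →+* ℂ} (V : HermSpace3 L ι₁) (c : SeesawCtx L),
      (thetaModelOf hHD hI h₁ h₃ h (embOf hHD hI h₁ h₃) (coverOf hHD hI h₁ h₃ hA) (wmOfInput W) (thetaOf _ (thetaClassInputOf _ (fun V c => thetaSpaceInputOf hHD hI h₁ h₃ S V c))) (d12Of μ) (d34Of μ)).GoodCtx ι₁ c → Module.finrank ℚ c.K = 6 →
      ∀ (i : Fin 4) (Γ : Level V), ∃ (M : CMField) (k : c.K →+* M) (σ' : M →+* ℂ), σ'.comp k = c.σ ∧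
        (thetaModelOf hHD hI h₁ h₃ h (embOf hHD hI h₁ h₃) (coverOf hHD hI h₁ h₃ hA) (wmOfInput W) (thetaOf _ (thetaClassInputOf _ (fun V c => thetaSpaceInputOf hHD hI h₁ h₃ S V c))) (d12Of μ) (d34Of μ)).Theta V c i Γ ⊆
          (picardCMUniverse hHD hI h₁ h₃).Uiso Γ M (inflate k (c.Ψ i)) σ' :=
  hLiu_of_smallLevel hHD hI h₁ h₃ h hA W S μ
    (hsmall_of_commonReflexInput hHD hI h₁ h₃ hR
      (thetaModelOf hHD hI h₁ h₃ h (embOf hHD hI h₁ h₃) (coverOf hHD hI h₁ h₃ hA) (wmOfInput W)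
        (thetaOf _ (thetaClassInputOf _ (fun V c => thetaSpaceInputOf hHD hI h₁ h₃ S V c))) (d12Of μ) (d34Of μ))
      hΘ)

end Model

end HodgeCM

end
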